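import Mathlib
import HarnessLib

/-!
# K6 crux `MuTransfer` (stmt-BirchSwinnertonDyer-19629), stub `stub_x9`: MU-TRANSFER-PROOF §4 LEMMA 4
# (the graph pairing has `T`-valuation `≤ 1`), kernel-checked — by a polarisation argument that needs
# neither Goursat nor `End_Ḡ E[p] = 𝔽_p`

Cell `bsd-smallim`, seat `bsd-smallim-k6-c2` (D-0074 group (F)). HONEST FRAMING: theorems only (no
definition, no named fact, D-0026); pure linear algebra over a field of characteristic `≠ 2`; nothing
is asserted about any curve and nothing is booked. Third KERNEL file for the registered stub `stub_x9`
(Kato μ-transfer on class X9 = KOLY-MEMO Thm. 5.7.1 / Cor. 5.7.2).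

**What Theorem A consumes from §4** (MU-TRANSFER-PROOF §5, Step 1, last sentence): for the
`G`-submodule `M = im(h, h^*) ⊂ 𝒯_e ⊕ 𝒯_e^*` cut out by the level-`e` classes `κ'_e` and `y_e`,
which projects ONTO both factors, "FIX `(x, x^*) ∈ M` with `ν := v_T(⟨x, x^*⟩_{A_e}) ≤ 1` (Lemma 4)".
The memo gets Lemma 4 from Lemma 3 (Goursat at level `e`; `Hom_G(𝒯_j, 𝒯_j^*) = ι`-semilinear scalars,
which uses `End_Ḡ E[p] = 𝔽_p`) and the explicit expansion (4.4). THIS FILE PROVES THE CONSUMED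
STATEMENT DIRECTLY, from three features of the situation only:

1. `M` is an `𝔽_p`-subspace stable under `γ − 1`, which acts on `𝒯_e = E[p] ⊗ A_e(χ)` as
   multiplication by `T` and on `𝒯_e^* ≅ E[p]^*(1) ⊗ A_e(χ^{-1})` (MU-TRANSFER-PROOF (4.1): "THE DUAL
   DEFORMATION CARRIES `χ^{-1}`") as multiplication by `ι(T) = (1+T)^{-1} − 1 = −T + T² − ⋯`; in
   `T`-adic coordinates (`x = Σ x_i T^i`, `x^* = Σ [y_j ⊗ T^j]`): `(Tx)_0 = 0`, `(Tx)_1 = x_0`,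
   `(ι(T)y)_0 = 0`, `(ι(T)y)_1 = −y_0`;
2. both projections of `M` are onto (only slot `0` is used);
3. the coefficients of the Gorenstein pairing (F7)/(4.2) are the convolution of the coordinates
   through the evaluation pairing `ev : E[p]^*(1) × E[p] → μ_p ≅ 𝔽_p`, which is non-degenerate:
   `⟨x, x^*⟩_0 = ev(y_0, x_0)`, `⟨x, x^*⟩_1 = ev(y_0, x_1) + ev(y_1, x_0)`.

**Proof (polarisation).** If `⟨·,·⟩_0` and `⟨·,·⟩_1` vanished identically on `M`, their cross
terms would vanish on `M × M`; evaluating the cross term of `⟨·,·⟩_1` at `(z, (γ−1)z')` gives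
`ev(y_0, x'_0) − ev(y'_0, x_0) = 0`, while the cross term of `⟨·,·⟩_0` at `(z, z')` gives
`ev(y_0, x'_0) + ev(y'_0, x_0) = 0`; so `2·ev(y_0, x'_0) = 0` for all `z, z' ∈ M`, and by 2. `ev ≡ 0`
— absurd. So some `z ∈ M` has `⟨z⟩_0 ≠ 0` or `⟨z⟩_1 ≠ 0`, i.e. `v_T ≤ 1` (`e ≥ 2`). This is WHY the
semilinearity of `ι` (`ι(T) ≡ −T`, not `+T`) defeats the alternation that forced hypothesis (ND) in
KOLY-MEMO 5.6.3: with `+T` the two cross-term identities would coincide instead of adding up.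
Consequently Theorem A needs Lemma 3 (i) (kernel: `…StubX9LevelE.lean`) only for Step 2's
Jordan–Hölder/Goursat DISJOINTNESS of fields, not for Lemma 4.

* `exists_mem_coeff_ne_zero_of_polarisation` — the abstract statement (any field with `2 ≠ 0`, any
  `k`-spaces `V`, `V'` with a pairing not identically zero, any subspace `M ≤ (ι → V) × (ι → V')` with
  the features 1.–2. at two indices `i₀ ≠ i₁`).
* `exists_mem_pairingCoeff_ne_zero` — the same in the memo's coordinates `Fin e → V`, `e ≥ 2`, with
  the operators `T` (shift) and `D = ι(T)` given through their first two coordinates.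

References: HOME/koly/MU-TRANSFER-PROOF.md §4 (Lemmas 3–4, (4.1)–(4.4)), §5 Step 1 (cell theorem,
referee PASS v4–v8; finite checks kit j245043); B. Howard, Compositio 140 (2004) Prop. 3.2.4 (the
`ι`-twisted pairing `e_Λ(λt, a) = e_Λ(t, λ^ι a)`, anticyclotomic prototype) [Howard2004HeegnerKolyvagin].
-/

-- the summit and its single problem are both named `BirchSwinnertonDyer` (registry layout D-0017)
set_option linter.dupNamespace false

set_option autoImplicit false

namespace Summit.BirchSwinnertonDyer.BirchSwinnertonDyer.Rank1Residual.LevelE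

variable {k : Type*} [Field k] {V V' : Type*} [AddCommGroup V] [Module k V] [AddCommGroup V']
  [Module k V']

/-- **MU-TRANSFER-PROOF §4 Lemma 4 (consumed form), abstract polarisation version.** Let `2 ≠ 0` in
`k`, `ev : V' × V → k` bilinear and not identically zero, `i₀ ≠ i₁` two indices, and
`M ≤ (ι → V) × (ι → V')` a subspace such that (1) for every `(x, y) ∈ M` some `(x', y') ∈ M` has
`x'_{i₀} = 0`, `x'_{i₁} = x_{i₀}`, `y'_{i₀} = 0`, `y'_{i₁} = −y_{i₀}` (the action of `γ − 1 = (T, ι(T))`),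
(2) the `i₀`-th coordinates of both projections of `M` exhaust `V` and `V'`. Then some `(x, y) ∈ M`
has `ev(y_{i₀}, x_{i₀}) ≠ 0` or `ev(y_{i₀}, x_{i₁}) + ev(y_{i₁}, x_{i₀}) ≠ 0`. [folklore] -/
theorem exists_mem_coeff_ne_zero_of_polarisation (h2 : (2 : k) ≠ 0) {ι : Type*} (i₀ i₁ : ι)
    (ev : V' →ₗ[k] V →ₗ[k] k) (hev : ∃ (y : V') (v : V), ev y v ≠ 0)
    (M : Submodule k ((ι → V) × (ι → V')))
    (hγ : ∀ z ∈ M, ∃ z' ∈ M,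
      z'.1 i₀ = 0 ∧ z'.1 i₁ = z.1 i₀ ∧ z'.2 i₀ = 0 ∧ z'.2 i₁ = -z.2 i₀)
    (h1 : ∀ v : V, ∃ z ∈ M, z.1 i₀ = v) (h2' : ∀ y : V', ∃ z ∈ M, z.2 i₀ = y) :
    ∃ z ∈ M, ev (z.2 i₀) (z.1 i₀) ≠ 0 ∨ ev (z.2 i₀) (z.1 i₁) + ev (z.2 i₁) (z.1 i₀) ≠ 0 := by
  by_contra hall
  push Not at hall
  -- both coefficients vanish identically on `M`
  have hP0 : ∀ z ∈ M, ev (z.2 i₀) (z.1 i₀) = 0 := fun z hz => (hall z hz).1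
  have hP1 : ∀ z ∈ M, ev (z.2 i₀) (z.1 i₁) + ev (z.2 i₁) (z.1 i₀) = 0 := fun z hz => (hall z hz).2
  -- cross terms on `M × M`
  have hC0 : ∀ z ∈ M, ∀ z' ∈ M, ev (z.2 i₀) (z'.1 i₀) + ev (z'.2 i₀) (z.1 i₀) = 0 := by
    intro z hz z' hz'
    have h := hP0 (z + z') (M.add_mem hz hz')
    simp only [Prod.fst_add, Prod.snd_add, Pi.add_apply, map_add, LinearMap.add_apply] at h
    rw [hP0 z hz, hP0 z' hz'] at h
    linear_combination h
  have hC1 : ∀ z ∈ M, ∀ z' ∈ M, ev (z.2 i₀) (z'.1 i₁) + ev (z.2 i₁) (z'.1 i₀) +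
      (ev (z'.2 i₀) (z.1 i₁) + ev (z'.2 i₁) (z.1 i₀)) = 0 := by
    intro z hz z' hz'
    have h := hP1 (z + z') (M.add_mem hz hz')
    simp only [Prod.fst_add, Prod.snd_add, Pi.add_apply, map_add, LinearMap.add_apply] at h
    have hz1 := hP1 z hz
    have hz'1 := hP1 z' hz'
    linear_combination h - hz1 - hz'1
  -- evaluate the cross term of `⟨·,·⟩_1` at `(z, (γ - 1) z')`
  have hkey : ∀ z ∈ M, ∀ z' ∈ M, ev (z.2 i₀) (z'.1 i₀) = 0 := by
    intro z hz z' hz'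
    obtain ⟨w, hw, hw1, hw2, hw3, hw4⟩ := hγ z' hz'
    have h := hC1 z hz w hw
    rw [hw1, hw2, hw3, hw4] at h
    simp only [map_zero, map_neg, LinearMap.zero_apply, LinearMap.neg_apply, add_zero,
      zero_add] at h
    have h0 := hC0 z hz z' hz'
    -- `h : ev y₀ x'₀ + 0 + (0 - ev y'₀ x₀) = 0`, `h0 : ev y₀ x'₀ + ev y'₀ x₀ = 0`
    have hsum : (2 : k) * ev (z.2 i₀) (z'.1 i₀) = 0 := by linear_combination h + h0
    rcases mul_eq_zero.mp hsum with h2' | h'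
    · exact absurd h2' h2
    · exact h'
  -- hence `ev ≡ 0`
  obtain ⟨y, v, hyv⟩ := hev
  obtain ⟨z, hz, hzy⟩ := h2' y
  obtain ⟨z', hz', hzv⟩ := h1 v
  have := hkey z hz z' hz'
  rw [hzy, hzv] at this
  exact hyv this

/-- **MU-TRANSFER-PROOF §4 Lemma 4 in the memo's coordinates (`e ≥ 2`).** `𝒯_e = V^e`, `𝒯_e^* ≃ V'^e`
(`Fin e → ·`, the `i`-th coordinate = coefficient of `T^i`); `T` and `D = ι(T)` linear operators with
`(Tx)_0 = 0`, `(Tx)_1 = x_0`, `(Dy)_0 = 0`, `(Dy)_1 = −y_0`; `M ≤ 𝒯_e × 𝒯_e^*` a subspace stable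
under `(T, D)` (= under `γ − 1`) whose two projections have all of `V`, `V'` as slot-`0` coordinates
(e.g. both projections onto); `ev` not identically zero and `2 ≠ 0` in `k`. Then some `(x, y) ∈ M`
has a Gorenstein pairing `⟨x, y⟩_{A_e} = Σ_n (Σ_{i+j=n} ev(y_j, x_i)) T^n` of `T`-valuation `≤ 1`:
its `T⁰`-coefficient `ev(y_0,x_0)` or its `T¹`-coefficient `ev(y_0,x_1) + ev(y_1,x_0)` is non-zero.
[folklore] -/
theorem exists_mem_pairingCoeff_ne_zero (h2 : (2 : k) ≠ 0) {e : ℕ} (he : 2 ≤ e)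
    (ev : V' →ₗ[k] V →ₗ[k] k) (hev : ∃ (y : V') (v : V), ev y v ≠ 0)
    (T : (Fin e → V) →ₗ[k] (Fin e → V)) (D : (Fin e → V') →ₗ[k] (Fin e → V'))
    (hT0 : ∀ x, T x ⟨0, by omega⟩ = 0) (hT1 : ∀ x, T x ⟨1, by omega⟩ = x ⟨0, by omega⟩)
    (hD0 : ∀ y, D y ⟨0, by omega⟩ = 0) (hD1 : ∀ y, D y ⟨1, by omega⟩ = -y ⟨0, by omega⟩)
    (M : Submodule k ((Fin e → V) × (Fin e → V')))
    (hM : ∀ z ∈ M, (T z.1, D z.2) ∈ M)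
    (h1 : ∀ v : V, ∃ z ∈ M, z.1 ⟨0, by omega⟩ = v)
    (h2' : ∀ y : V', ∃ z ∈ M, z.2 ⟨0, by omega⟩ = y) :
    ∃ z ∈ M, ev (z.2 ⟨0, by omega⟩) (z.1 ⟨0, by omega⟩) ≠ 0 ∨
      ev (z.2 ⟨0, by omega⟩) (z.1 ⟨1, by omega⟩) + ev (z.2 ⟨1, by omega⟩) (z.1 ⟨0, by omega⟩) ≠ 0 :=
  exists_mem_coeff_ne_zero_of_polarisation h2 ⟨0, by omega⟩ ⟨1, by omega⟩ ev hev M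
    (fun z hz => ⟨(T z.1, D z.2), hM z hz, hT0 _, hT1 _, hD0 _, hD1 _⟩) h1 h2'

end Summit.BirchSwinnertonDyer.BirchSwinnertonDyer.Rank1Residual.LevelE
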